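import Literature.NumberTheory.EllipticCurves.Castella2018.HidaMemberFormsSigmaFramesCongruence
import Summits.BirchSwinnertonDyer.Rank1Residual.X11b.RouteR1IntReceptacle
import Summits.BirchSwinnertonDyer.BirchSwinnertonDyer.Theorems.EisensteinPrimesBSDpOnCellCMemberInvariantsOfAnacongWt
import HarnessLib

/-!
# Crux 4 `BSDpOnCellC` (stmt-BirchSwinnertonDyer-19034), line «crystal» (skeleton of record v9, LEAD `cruxlead-19034`): the REGISTERED stub
# `stub_crystallineFibre` (I) «the crystalline fibre congruence», ITS TEXT TOKEN FOR TOKEN, from the Literature statement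
# `Castella2018.cas20_thm211_memberForms_sigmaFrames_congr` (Castella 2020 Thm. 2.11 ∘ Castella 2018 (3.1)/(4.1) ∘ Skinner 2016 §2.6, the
# form-level image-free member congruences) at depth `m = 1`, weight class `r = 0`
# (cell `bsd-eis`, width seat `bsd-line-x2-p2` g13; `--supports stmt-BirchSwinnertonDyer-19034`; the skeleton is the LEAD's — W-79)

WHAT THIS GIVES THE LEAD. `crystallineFibre_of_cas20 hcas : <stub_crystallineFibre, v9 text>` from
`hcas : Castella2018.cas20_thm211_memberForms_sigmaFrames_congr`, so a v10 can DROP `stub_crystallineFibre` (I) and carry `hcas` as a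
conjunct of `stub_publishedFacts` (PUB-chain, riders `MF-chain`/`MF-anyframe`/`MF-p3`/`MF-hK`/`MF-sp-factor`/`MF-sigma` written out in the
Literature module docstring — the label is the referee's). With x2-p2 g13's #2 (`MemberInvariantsOfAnacongWt.memberInvariants_of_anacongWt`,
p693188) the member side of crystal — (I), (i), (ii′) — is then NAMED PRINT throughout.

PROOF CONTENT: bookkeeping — `CellC ⟹ 2 < p ∧ Mult` (x2-p2 g13's `MemberInvariantsOfAnacongWt.two_lt_of_cellC` / `mult_of_cellC`, p693188); the weight-2 frame `R1.IsBDPLFunctionInt p ι' 𝔭 κ γ f ΩK Ωp Q` (Summits receptacle)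
IS the Literature frame `IsBDPLFunctionWtSigmaInt ι' 𝔭 κ γ f ∅ ΩK Ωp Q` (`bdpInterpolationValueWtSigma_empty_two`; `(2:ℤ)/2 ≤ n ↔ 0 < n`);
the receptacle map is `R1.toCpInt p` (`R1.coe_toCpInt`); `m = 1`, `r = 0` (`p ^ 1`, `p ^ 0`).

HONEST FRAMING: an IMPLICATION between hypothesis-shaped statements; 0 defs, 0 sorry, no new named fact; nothing about any curve is asserted;
no summit statement / BSD / MC / IMC is proved; 0 cells / labels / tiers move; the registered stub is NOT closed by this file alone (it becomes
an instance of ONE named Literature statement — the LEAD decides whether to reshape).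

References: [Castella2020JIMJ] Def. 2.10, Thm. 2.11; [Castella2018] Thm. 3.1, (3.1), (4.1); [Castella2018Erratum] (a)(c); [Skinner2016PacificMC]
§2.6; cell `Cruxes/BSDpOnCellC/STUB-PLAN-memberInvariants.md` §2, `Lines/crystal.lean` v9.
-/

set_option autoImplicit false
set_option linter.dupNamespace false

noncomputable section

open scoped Classical MatrixGroups ModularForm

open CongruenceSubgroup WeierstrassCurve NumberField IsDedekindDomain Field PowerSeries
  Literature.NumberTheory.EllipticCurves Literature.NumberTheory.EllipticCurves.GreenbergSelmer
  Literature.NumberTheory.EllipticCurves.ModularForms Literature.NumberTheory.QuadraticFields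
  Literature.NumberTheory.EllipticCurves.Rank1Residual
  Literature.NumberTheory.EllipticCurves.Rank1Residual.Typed
  Literature.NumberTheory.EllipticCurves.Castella2018
  Literature.NumberTheory.GaloisRepresentations
  Summit.BirchSwinnertonDyer.Rank1Residual.X11b
  Summit.BirchSwinnertonDyer.Rank1Residual Summit.BirchSwinnertonDyer.Rank1Residual.X2

namespace Summit.BirchSwinnertonDyer.BirchSwinnertonDyer.Theorems.CrystallineFibreOfCas20

/-- The Summits weight-2 receptacle `R1.IsBDPLFunctionInt` IS the Literature frame `IsBDPLFunctionWtSigmaInt … 2 … ∅` (Castella 2018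
Thm. 3.1 read in `𝓞_{ℂ_p}⟦T⟧`; `bdpInterpolationValueWtSigma_empty_two`, and `2/2 ≤ n ↔ 0 < n`). [cite: Castella2018, Thm. 3.1 (arXiv:1704.06608 p. 9)] -/
theorem isBDPLFunctionWtSigmaInt_empty_of_isBDPLFunctionInt {p : ℕ} [Fact p.Prime] {K : Type} [Field K] [NumberField K] {N : ℕ}
    {ι : PadicAlgCl p ≃+* ℂ} {𝔭 : HeightOneSpectrum (𝓞 K)} {κ : ZpExtension K p} {γ : Field.absoluteGaloisGroup K}
    {f : CuspForm (CongruenceSubgroup.Gamma0 N) 2} {ΩK : ℂ} {Ωp : ℂ_[p]} {Q : PowerSeries 𝓞_ℂ_[p]}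
    (hQ : R1.IsBDPLFunctionInt p ι 𝔭 κ γ f ΩK Ωp Q) : IsBDPLFunctionWtSigmaInt ι 𝔭 κ γ f ∅ ΩK Ωp Q := by
  intro φ n hn hunr hinf r hr hκ
  rw [bdpInterpolationValueWtSigma_empty_two]
  exact hQ φ n (by omega) hunr hinf r hr hκ

/-- **`stub_crystallineFibre` (I) of crystal v9, ITS REGISTERED TEXT TOKEN FOR TOKEN, from `cas20_thm211_memberForms_sigmaFrames_congr`
at `m = 1`, `r = 0`** (member periods := the frame's own; receptacle map `R1.toCpInt p`).
[cite: Castella2020JIMJ, Def. 2.10 and Thm. 2.11] [cite: Castella2018, Thm. 3.1, (3.1), (4.1)] [cite: Castella2018Erratum, proof of Thm. 1.1 (a)(c) (p. 4)]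
[cite: Skinner2016PacificMC, §2.6] -/
theorem crystallineFibre_of_cas20 (hcas : cas20_thm211_memberForms_sigmaFrames_congr) :

    ∀ (W : WeierstrassCurve ℚ) [W.IsElliptic] [W.IsGloballyMinimal] (p : ℕ) [Fact p.Prime],
      ∀ (N : ℕ) [NeZero N] (K : Type) [Field K] [NumberField K],
        CellC W p → W.conductorNorm ℤ = N →
        IsImaginaryQuadratic K → NumberField.discr K < -4 → SatisfiesHeegnerHypothesis N K →
        Odd (NumberField.discr K) →
        ∀ (κ : ZpExtension K p), κ.IsAnticyclotomic →
          ∀ (γ : Field.absoluteGaloisGroup K) [Fact (κ.IsTopGenerator γ)]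
            (𝔭 : HeightOneSpectrum (𝓞 K)), ((p : ℕ) : 𝓞 K) ∈ 𝔭.asIdeal →
            𝔭.asIdeal.ramificationIdx (𝓞 ℚ) = 1 → 𝔭.asIdeal.inertiaDeg (𝓞 ℚ) = 1 →
            ∀ (𝔭bar : HeightOneSpectrum (𝓞 K)), ((p : ℕ) : 𝓞 K) ∈ 𝔭bar.asIdeal → 𝔭bar ≠ 𝔭 →
              ((Ideal.span {(p : ℤ)}).primesOver (𝓞 K)).ncard = 2 →
            ∀ (f : CuspForm (CongruenceSubgroup.Gamma0 N) 2), IsNewformOf W f →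
              ∀ (ι' : PadicAlgCl p ≃+* ℂ),
                (∀ (w : InfinitePlace K) (k : 𝓞 K),
                  k ∈ 𝔭.asIdeal ↔ ‖ι'.symm (w.embedding (k : K))‖ < 1) →
                ∀ (ΩK : ℂ) (Ωp : ℂ_[p]) (Q : PowerSeries 𝓞_ℂ_[p]), ΩK ≠ 0 → ‖Ωp‖ = 1 →
                  R1.IsBDPLFunctionInt p ι' 𝔭 κ γ f ΩK Ωp Q →
                  ∃ (D : Skinner2016.HidaCongruentForm W p 1) (ΩK' : ℂ) (Ωp' : ℂ_[p])
                    (Qg : PowerSeries 𝓞_ℂ_[p]),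
                    (∀ x : coeffField D.g, ι' (D.ι x) = (x : ℂ)) ∧ 2 * ((p : ℤ) - 1) ∣ D.k - 2 ∧
                    ΩK' ≠ 0 ∧ ‖Ωp'‖ = 1 ∧
                    IsBDPLFunctionWtSigmaInt ι' 𝔭 κ γ D.g (W.sigmaPlacesFinset p K) ΩK' Ωp' Qg ∧
                    Ideal.span {Qg} ⊔ Ideal.span {(C ((p : ℕ) : 𝓞_ℂ_[p]) : PowerSeries 𝓞_ℂ_[p])} =
                      Ideal.span {Q * PowerSeries.map (R1.toCpInt p) (W.sigmaEulerElement p K κ)} ⊔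
                        Ideal.span {(C ((p : ℕ) : 𝓞_ℂ_[p]) : PowerSeries 𝓞_ℂ_[p])}  := by
  intro W _ _ p _ N _ K _ _ hC hN hK hdisc hH hodd κ hκ γ _ 𝔭 h𝔭 _hram _hdeg 𝔭bar _h𝔭bar _hne hsplit f hf ι' hι' ΩK Ωp Q hΩK hΩp hQ
  obtain ⟨D, Qm, hD, hk, hQm, hc⟩ := hcas ι' W K 𝔭 κ γ hf hN (MemberInvariantsOfAnacongWt.two_lt_of_cellC hC)
    (MemberInvariantsOfAnacongWt.mult_of_cellC hC) hK hodd hdisc hH hsplit h𝔭 hι' hκ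
    (R1.toCpInt p) (R1.coe_toCpInt p) ΩK Ωp Q hΩK hΩp (isBDPLFunctionWtSigmaInt_empty_of_isBDPLFunctionInt hQ) 1 le_rfl 0
  refine ⟨D, ΩK, Ωp, Qm, hD, ?_, hΩK, hΩp, hQm, ?_⟩
  · simpa using hk
  · simpa only [pow_one] using hc

end Summit.BirchSwinnertonDyer.BirchSwinnertonDyer.Theorems.CrystallineFibreOfCas20

end
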